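import Summits.HubbardSuperconductivity.HubbardSuperconductivity.Theorems.NoNormalLimitState.Negative.NoUniformAtomFloorMeso
import Summits.HubbardSuperconductivity.HubbardSuperconductivity.Theorems.InfiniteVolumeFirstCoarseTightnessMesoCeiling

/-!
# `NoNormalLimitState`: the U-uniform atom floor is false — UNCONDITIONALLY

Negative-side support for the crux `NoNormalLimitState` (stmt-HubbardSuperconductivity-18533, route
`InfiniteVolumeFirst`). The crux asserts `∃ δ ∀ U₀ ∃ U ∈ (0,U₀)`: every torus-limit atom of every
admissible family is POSITIVE — the atom may depend on `U` (and on the family). Its U-UNIFORM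
strengthening `∃ δ ∃ a > 0 ∀ U₀ ∃ U ∈ (0,U₀)`: all those atoms are `≥ a` was refuted twice before, each
time modulo an open input: modulo the rank-3 crux `NoInfraredPileUp` (`Negative/NoUniformAtomFloor.lean`,
cdisprove p146340) and modulo the mesoscopic pair-order ceiling (MC)
(`Negative/NoUniformAtomFloorMeso.lean`, p152837). The ceiling (MC) is now a THEOREM — the coarse-tightness
programme's `CoarseTightness.stub_coarseMesoCeiling` (p153059: `𝓜_R(ψ) ≤ 16512/R + 65536√τ +
(128/√τ)√(U + (72+32π)/R)` for every unit sector ground state of `hubbardTorus 2 L 1 U`, `U ∈ [0,1]`,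
`2R+2 ≤ L`, from the local kinetic budget on Dirichlet blocks) — so the strengthening is false outright:

* `stub_uniformFloorFalse` (registered stub of the crux item) — `¬ (∃ δ ∈ (0,½) ∃ a > 0 ∀ U₀ > 0 ∃ U ∈ (0,U₀),`
  `every admissible family's torus-limit atoms are ≥ a)`.

Consequently any proof of the crux must let the atom `a(U) → 0⁺` (at rate at most `65664·U^{1/4}`,
`CoarseTightness.atomCeiling_holds`); the crux's own `∃ U` after `∀ U₀` is exactly what keeps it
consistent with this. This closes the near-miss named in the disprover's `Cruxes/NoNormalLimitState/
Disproof.lean` §3 ("window pairing-cost lemma would make §3 unconditional"). Three-line composition of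
landed theorems; no definition and no named fact is introduced. Source of the mechanism:
T. Kennedy, E. H. Lieb, B. S. Shastry, PRL 61 (1988) 2582 (kinetic-energy bounds on pair order).
-/

noncomputable section

-- the mandated namespace `Summit.<Summit>.<Problem>.Theorems` repeats `HubbardSuperconductivity`
-- (single-problem summit, D-0017), which the `dupNamespace` linter flags on every declaration
set_option linter.dupNamespace false

namespace Summit.HubbardSuperconductivity.HubbardSuperconductivity.Theorems.NoNormalLimitState.Negative

open Literature.MathematicalPhysics.QuantumLattice Literature.Probability.LatticeModels Matrix Finset
  Filter
open Summit.HubbardSuperconductivity.HubbardSuperconductivity.Theorems.CoarseTightness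
open scoped ComplexConjugate ComplexOrder Topology

/-- **The U-uniform atom floor is false, unconditionally** (registered stub `stub_uniformFloorFalse` of
crux stmt-HubbardSuperconductivity-18533). There is NO doping `δ ∈ (0,½)` and floor `a > 0` such that
at arbitrarily weak coupling every admissible ground-state family's torus-limit condensate atoms are
`≥ a`: the landed mesoscopic ceiling `stub_coarseMesoCeiling` (p153059) feeds
`noNormalLimitState_uniformFloor_false_of_mesoCeiling` (p152837) — atoms are `≤ 65664·U^{1/4}`, families
and convergent subsequences exist at every `U`. Kennedy–Lieb–Shastry, PRL 61 (1988) 2582. [folklore] -/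
theorem stub_uniformFloorFalse : ¬ (∃ δ ∈ Set.Ioo (0:ℝ) (1 / 2), ∃ a : ℝ, 0 < a ∧ ∀ U₀ : ℝ, 0 < U₀ → ∃ U ∈ Set.Ioo (0:ℝ) U₀, ∀ (N : ℕ → ℕ) (ψ : ∀ L, Fock (Orb (FermionTorus 2 L))), (∀ L, Even L → N L = 2 * ⌊(1 - δ) * (L : ℝ) ^ 2 / 2⌋₊ ∧ star (ψ L) ⬝ᵥ ψ L = 1 ∧ IsGroundStateInSector (hubbardTorus 2 L 1 U) (N L) 0 (ψ L)) → ∀ (Ls : ℕ → ℕ) (C : Site 2 → ℝ), StrictMono Ls → (∀ j, Even (Ls j)) → (∀ x : Site 2, Tendsto (fun j : ℕ => (∑ y ∈ halfOpenBox 2 (Ls j), torusPullback (pairFieldCorr dWaveFormFactor ψ) (Ls j) (x + y) y) / ((Ls j : ℕ) : ℝ) ^ 2) atTop (𝓝 (C x))) → a ≤ liminf (fun R : ℕ => (∑ x ∈ halfOpenBox 2 R, ∑ y ∈ halfOpenBox 2 R, C (x - y)) / ((R : ℕ) : ℝ) ^ 4) atTop) :=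
  noNormalLimitState_uniformFloor_false_of_mesoCeiling (by norm_num) (by norm_num) stub_coarseMesoCeiling

end Summit.HubbardSuperconductivity.HubbardSuperconductivity.Theorems.NoNormalLimitState.Negative

end
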